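import Literature.NumberTheory.EllipticCurves.DeShalit1987.KatzTwoVariablePAdicLFunction
import Literature.NumberTheory.EllipticCurves.Rubin1991.TwoVariableMainConjecture
import Literature.NumberTheory.GaloisRepresentations.AbsGaloisGroupCompact
import Mathlib.NumberTheory.Padics.RingHoms
import HarnessLib

/-!
# Bridge between the two typed frames of the TWO-VARIABLE Katz–de Shalit `p`-adic `L`-function
# (de Shalit 1987, II.4.17 (54)): `DeShalit1987.IsKatzSheet` on `𝒪_{ℂ_p}⟦T₁,T₂⟧ = MvPowerSeries (Fin 2)`
# (cell `bsd-goldfeld`) and `IsKatzMeasure₂` on `𝒪_{ℂ_p}⟦T₂⟧⟦T₁⟧ = PowerSeries (PowerSeries ·)`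
# (cell `bsd-eis`) — proofs only, NO new fact

Two seats typed de Shalit's two-variable function on the same day (2026-08-26) in the two natural
receptacles: `DeShalit1987/KatzTwoVariablePAdicLFunction.lean` (`IsKatzSheet`, existence fact
`DeShalit1987.thmII417_exists_katzSheet`, `p` of ANY parity) and
`Rubin1991/TwoVariableMainConjecture.lean` (`IsKatzMeasure₂`, used inside the `2 < p` facts
`Rubin1991.thm41_exists_katzMeasure₂_charIdeal_eq` / `thm53_…`). This file proves that the two frames
say the same thing, so that neither is a dead end:

* `ZpExtension.isDualBasis_iff_isTopGeneratorPair`, `DeShalit1987.factorsThroughZp₂_iff_factorsThroughPair`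
  — the `ℤ_p²`-frame predicates coincide (definitionally);
* `ZpExtension.IsDualBasis.isIndependent` — a dual basis FORCES independence (joint surjectivity of
  `(κ₁, κ₂) : Γ_K → ℤ_p²`): the image is a compact, hence closed, subgroup containing `(1,0)` and `(0,1)`,
  and `ℤ² ⊆ ℤ_p²` is dense — so the extra binder `IsIndependent` of `thmII417_exists_katzSheet` is
  automatic (the remark (D1) of the `Rubin1991` file, proved);
* `MvPowerSeries.toNested` / `MvPowerSeries.ofNested` — the coefficientwise dictionary
  `𝒪⟦T₁,T₂⟧ ⇄ 𝒪⟦T₂⟧⟦T₁⟧` (`[T₁^i T₂^j]`), inverse to each other;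
* `DeShalit1987.IntSeries₂.hasValueAt_iff_hasValueAt₂_toNested` — the two value predicates agree
  (`HasSum` over `Fin 2 →₀ ℕ` vs over `ℕ × ℕ`, `Equiv.hasSum_iff`);
* `DeShalit1987.isKatzSheet_iff_isKatzMeasure₂_toNested` (and the `ofNested` form) — THE SAME PREDICATE;
* `DeShalit1987.thmII417_exists_katzSheet.exists_isKatzMeasure₂` — hence the parity-free existence fact
  of the `bsd-goldfeld` file delivers, for every prime `p` INCLUDING `p = 2`, a `G ∈ 𝒪_{ℂ_p}⟦T₂⟧⟦T₁⟧`
  with `IsKatzMeasure₂ ι v v̄ S κ₁ κ₂ γ₁ γ₂ λ Ω δ Ω_p G` for every generator pair — the analytic input of the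
  `bsd-eis` frame at `p = 2` (its own facts assume `2 < p` with Rubin 1991).

References: [deShalit1987] II.4.17 (54) (p. 78); the module docstrings of the two bridged files.
-/

noncomputable section

open scoped Classical
open NumberField IsDedekindDomain Field
open Literature.NumberTheory.GaloisRepresentations

universe u

namespace Literature.NumberTheory.EllipticCurves

/-! ### §1. The `ℤ_p²`-frame predicates coincide -/

section Frame

variable {K : Type u} [Field K] {p : ℕ} [Fact p.Prime]

/-- `IsDualBasis` (goldfeld frame) and `IsTopGeneratorPair` (eis frame) are the same predicate
(`γ ∈ ker κ ↔ κ γ = 1` is definitional). [cite: deShalit1987, II.4.17 (54) (p. 78)] -/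
theorem ZpExtension.isDualBasis_iff_isTopGeneratorPair {κ₁ κ₂ : ZpExtension K p}
    {γ₁ γ₂ : absoluteGaloisGroup K} :
    κ₁.IsDualBasis κ₂ γ₁ γ₂ ↔ ZpExtension.IsTopGeneratorPair κ₁ κ₂ γ₁ γ₂ :=
  Iff.rfl

/-- `FactorsThroughZp₂` (goldfeld frame) and `FactorsThroughPair` (eis frame) are the same predicate.
[cite: deShalit1987, II.4.17 (54) (p. 78)] -/
theorem DeShalit1987.factorsThroughZp₂_iff_factorsThroughPair {A : Type*} [CommRing A]
    [TopologicalSpace A] {κ₁ κ₂ : ZpExtension K p} {r : FramedGaloisRep K A 1} :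
    DeShalit1987.FactorsThroughZp₂ κ₁ κ₂ r ↔ FactorsThroughPair κ₁ κ₂ r :=
  Iff.rfl

/-- **A dual basis forces independence**: if `κ₁(γ₁) = 1, κ₂(γ₁) = 0, κ₁(γ₂) = 0, κ₂(γ₂) = 1` then
`σ ↦ (κ₁σ, κ₂σ)` maps `Γ_K` ONTO `ℤ_p × ℤ_p`. The image is a compact (so closed) subgroup of `ℤ_p²`
(`Γ_K` is compact, `κ_i` continuous) containing `ℤ(1,0) + ℤ(0,1)`, which is dense
(`PadicInt.denseRange_intCast`). This is the remark (D1) of `Rubin1991/TwoVariableMainConjecture.lean`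
("a generator pair forces `Γ_K/pairKer ≅ ℤ_p²`"), proved. [cite: deShalit1987, II.4.17 (p. 77–78)] -/
theorem ZpExtension.IsDualBasis.isIndependent {κ₁ κ₂ : ZpExtension K p} {γ₁ γ₂ : absoluteGaloisGroup K}
    (h : κ₁.IsDualBasis κ₂ γ₁ γ₂) : κ₁.IsIndependent κ₂ := by
  haveI : CompactSpace (absoluteGaloisGroup K) := absoluteGaloisGroup_compactSpace K
  -- the joint map as a continuous monoid homomorphism
  let f : absoluteGaloisGroup K →* Multiplicative ℤ_[p] × Multiplicative ℤ_[p] :=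
    MonoidHom.prod κ₁.toContinuousMonoidHom.toMonoidHom κ₂.toContinuousMonoidHom.toMonoidHom
  have hf : Continuous f :=
    (map_continuous κ₁.toContinuousMonoidHom).prodMk (map_continuous κ₂.toContinuousMonoidHom)
  have hf_apply : ∀ σ, f σ = (κ₁ σ, κ₂ σ) := fun _ ↦ rfl
  -- its range is closed
  have hclosed : IsClosed (Set.range f) := (isCompact_range hf).isClosed
  -- every pair of integers is attained: `f (γ₁^m γ₂^n) = (m, n)`
  have hint : ∀ m n : ℤ,
      (Multiplicative.ofAdd (m : ℤ_[p]), Multiplicative.ofAdd (n : ℤ_[p])) ∈ Set.range f := by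
    intro m n
    refine ⟨γ₁ ^ m * γ₂ ^ n, ?_⟩
    obtain ⟨h₁, h₂, h₃, h₄⟩ := h
    rw [hf_apply, map_mul, map_zpow, map_zpow, map_mul, map_zpow, map_zpow]
    change (κ₁ γ₁ ^ m * κ₁ γ₂ ^ n, κ₂ γ₁ ^ m * κ₂ γ₂ ^ n) = _
    rw [h₁, h₂, h₃, h₄, one_zpow, one_zpow, mul_one, one_mul]
    refine Prod.ext ?_ ?_ <;>
      simp [← ofAdd_zsmul]
  -- density of `ℤ × ℤ` in `ℤ_p × ℤ_p`, transported through `ofAdd`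
  intro xy
  obtain ⟨x, y⟩ := xy
  have hdense : DenseRange (fun mn : ℤ × ℤ ↦
      (Multiplicative.ofAdd (mn.1 : ℤ_[p]), Multiplicative.ofAdd (mn.2 : ℤ_[p]))) := by
    have h1 : DenseRange (fun m : ℤ ↦ Multiplicative.ofAdd (m : ℤ_[p])) :=
      Multiplicative.ofAdd.surjective.denseRange.comp PadicInt.denseRange_intCast
        continuous_ofAdd
    exact h1.prodMap h1
  have hmem : (x, y) ∈ closure (Set.range fun mn : ℤ × ℤ ↦
      (Multiplicative.ofAdd (mn.1 : ℤ_[p]), Multiplicative.ofAdd (mn.2 : ℤ_[p]))) :=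
    hdense.closure_range ▸ Set.mem_univ _
  have hsub : Set.range (fun mn : ℤ × ℤ ↦
      (Multiplicative.ofAdd (mn.1 : ℤ_[p]), Multiplicative.ofAdd (mn.2 : ℤ_[p]))) ⊆ Set.range f := by
    rintro _ ⟨⟨m, n⟩, rfl⟩
    exact hint m n
  have : (x, y) ∈ Set.range f := hclosed.closure_subset_iff.mpr hsub hmem
  obtain ⟨σ, hσ⟩ := this
  exact ⟨σ, (hf_apply σ).symm.trans hσ⟩

end Frame

/-! ### §2. The receptacles `𝒪⟦T₁,T₂⟧ ⇄ 𝒪⟦T₂⟧⟦T₁⟧` -/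

section Receptacle

variable {R : Type*} [CommSemiring R]

/-- The exponent `(i, j) ↦ [T₁^i T₂^j]` as an element of `Fin 2 →₀ ℕ`. [folklore] -/
def MvPowerSeries.finTwoExponent (i j : ℕ) : Fin 2 →₀ ℕ :=
  Finsupp.equivFunOnFinite.symm ![i, j]

/-- The `T₁`-exponent of `[T₁^i T₂^j]` is `i`. [cite: deShalit1987, II.4.17 (54) (p. 78)] -/
@[simp] theorem MvPowerSeries.finTwoExponent_apply_zero (i j : ℕ) :
    MvPowerSeries.finTwoExponent i j 0 = i := by
  simp [MvPowerSeries.finTwoExponent]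

/-- The `T₂`-exponent of `[T₁^i T₂^j]` is `j`. [cite: deShalit1987, II.4.17 (54) (p. 78)] -/
@[simp] theorem MvPowerSeries.finTwoExponent_apply_one (i j : ℕ) :
    MvPowerSeries.finTwoExponent i j 1 = j := by
  simp [MvPowerSeries.finTwoExponent]

/-- Every exponent is `finTwoExponent (n 0) (n 1)` (the two variables of (54) exhaust `Fin 2`). [cite: deShalit1987, II.4.17 (54) (p. 78)] -/
theorem MvPowerSeries.finTwoExponent_eq (n : Fin 2 →₀ ℕ) :
    MvPowerSeries.finTwoExponent (n 0) (n 1) = n := by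
  ext k
  fin_cases k <;> simp

/-- The exponent map as an equivalence `ℕ × ℕ ≃ (Fin 2 →₀ ℕ)`. [folklore] -/
def MvPowerSeries.finTwoExponentEquiv : ℕ × ℕ ≃ (Fin 2 →₀ ℕ) where
  toFun ij := MvPowerSeries.finTwoExponent ij.1 ij.2
  invFun n := (n 0, n 1)
  left_inv ij := by simp
  right_inv n := MvPowerSeries.finTwoExponent_eq n

/-- Unfolding `finTwoExponentEquiv`. [cite: deShalit1987, II.4.17 (54) (p. 78)] -/
@[simp] theorem MvPowerSeries.finTwoExponentEquiv_apply (ij : ℕ × ℕ) :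
    MvPowerSeries.finTwoExponentEquiv ij = MvPowerSeries.finTwoExponent ij.1 ij.2 :=
  rfl

/-- **`𝒪⟦T₁,T₂⟧ → 𝒪⟦T₂⟧⟦T₁⟧`**: `[T₂^j]([T₁^i] (toNested M)) = [T₁^i T₂^j] M` (outer variable `T₁` =
index `0`, inner `T₂` = index `1`, the convention of `IsKatzMeasure₂`). [folklore] -/
def MvPowerSeries.toNested (M : MvPowerSeries (Fin 2) R) : PowerSeries (PowerSeries R) :=
  PowerSeries.mk fun i ↦ PowerSeries.mk fun j ↦ MvPowerSeries.coeff (MvPowerSeries.finTwoExponent i j) M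

/-- **`𝒪⟦T₂⟧⟦T₁⟧ → 𝒪⟦T₁,T₂⟧`**: `[T^n] (ofNested G) = [T₂^{n 1}]([T₁^{n 0}] G)`. [folklore] -/
def MvPowerSeries.ofNested (G : PowerSeries (PowerSeries R)) : MvPowerSeries (Fin 2) R :=
  fun n ↦ PowerSeries.coeff (n 1) (PowerSeries.coeff (n 0) G)

/-- The coefficient dictionary `[T₂^j]([T₁^i] (toNested M)) = [T₁^i T₂^j] M`. [cite: deShalit1987, II.4.17 (54) (p. 78)] -/
@[simp] theorem MvPowerSeries.coeff_coeff_toNested (M : MvPowerSeries (Fin 2) R) (i j : ℕ) :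
    PowerSeries.coeff j (PowerSeries.coeff i (MvPowerSeries.toNested M)) =
      MvPowerSeries.coeff (MvPowerSeries.finTwoExponent i j) M := by
  simp [MvPowerSeries.toNested, PowerSeries.coeff_mk]

/-- The coefficient dictionary `[T^n] (ofNested G) = [T₂^{n 1}]([T₁^{n 0}] G)`. [cite: deShalit1987, II.4.17 (54) (p. 78)] -/
@[simp] theorem MvPowerSeries.coeff_ofNested (G : PowerSeries (PowerSeries R)) (n : Fin 2 →₀ ℕ) :
    MvPowerSeries.coeff n (MvPowerSeries.ofNested G) =
      PowerSeries.coeff (n 1) (PowerSeries.coeff (n 0) G) :=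
  rfl

/-- `toNested ∘ ofNested = id`: the two receptacles of (54) are in bijection. [cite: deShalit1987, II.4.17 (54) (p. 78)] -/
@[simp] theorem MvPowerSeries.toNested_ofNested (G : PowerSeries (PowerSeries R)) :
    MvPowerSeries.toNested (MvPowerSeries.ofNested G) = G := by
  ext i j
  simp

/-- `ofNested ∘ toNested = id`: the two receptacles of (54) are in bijection. [cite: deShalit1987, II.4.17 (54) (p. 78)] -/
@[simp] theorem MvPowerSeries.ofNested_toNested (M : MvPowerSeries (Fin 2) R) :
    MvPowerSeries.ofNested (MvPowerSeries.toNested M) = M := by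
  ext n
  rw [MvPowerSeries.coeff_ofNested, MvPowerSeries.coeff_coeff_toNested, MvPowerSeries.finTwoExponent_eq]

/-- The constant terms (values at the trivial character) agree in the two receptacles. [cite: deShalit1987, II.4.17 (54) (p. 78)] -/
theorem MvPowerSeries.constantCoeff_constantCoeff_toNested (M : MvPowerSeries (Fin 2) R) :
    PowerSeries.constantCoeff (PowerSeries.constantCoeff (MvPowerSeries.toNested M)) =
      MvPowerSeries.constantCoeff M := by
  rw [← PowerSeries.coeff_zero_eq_constantCoeff_apply, ← PowerSeries.coeff_zero_eq_constantCoeff_apply]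
  have h0 : MvPowerSeries.finTwoExponent 0 0 = 0 := by ext k; fin_cases k <;> simp
  rw [show PowerSeries.coeff 0 (PowerSeries.coeff 0 (MvPowerSeries.toNested M)) =
      MvPowerSeries.coeff (MvPowerSeries.finTwoExponent 0 0) M from
    MvPowerSeries.coeff_coeff_toNested M 0 0, h0, MvPowerSeries.coeff_zero_eq_constantCoeff_apply]

end Receptacle

/-! ### §3. The value predicates and the Katz predicates agree -/

section Values

variable {p : ℕ} [Fact p.Prime]

/-- **The two value predicates agree**: `M(x, y) = v` in the `MvPowerSeries` receptacle iff
`(toNested M)(x, y) = v` in the nested receptacle (the `HasSum` over `Fin 2 →₀ ℕ` vs over `ℕ × ℕ` along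
`finTwoExponentEquiv`). [cite: deShalit1987, II.4.17 (54) (p. 78)] -/
theorem DeShalit1987.IntSeries₂.hasValueAt_iff_hasValueAt₂_toNested
    (M : MvPowerSeries (Fin 2) (PadicComplexInt p)) (x y v : ℂ_[p]) :
    DeShalit1987.IntSeries₂.HasValueAt M x y v ↔
      IntSeries.HasValueAt₂ (MvPowerSeries.toNested M) x y v := by
  unfold DeShalit1987.IntSeries₂.HasValueAt IntSeries.HasValueAt₂
  rw [← Equiv.hasSum_iff MvPowerSeries.finTwoExponentEquiv]
  refine Iff.of_eq (congrArg (fun g ↦ HasSum g v) ?_)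
  ext ⟨i, j⟩
  simp [Function.comp]

/-- The same for the nested-to-multivariate direction. [cite: deShalit1987, II.4.17 (54) (p. 78)] -/
theorem DeShalit1987.IntSeries₂.hasValueAt_ofNested_iff (G : PowerSeries (PowerSeries (PadicComplexInt p)))
    (x y v : ℂ_[p]) :
    DeShalit1987.IntSeries₂.HasValueAt (MvPowerSeries.ofNested G) x y v ↔ IntSeries.HasValueAt₂ G x y v := by
  rw [DeShalit1987.IntSeries₂.hasValueAt_iff_hasValueAt₂_toNested, MvPowerSeries.toNested_ofNested]

variable {K : Type u} [Field K] [NumberField K]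
  {ι : PadicAlgCl p ≃+* ℂ} {v vbar : HeightOneSpectrum (𝓞 K)}
  {S : Finset (HeightOneSpectrum (𝓞 K))} {κ₁ κ₂ : ZpExtension K p} {γ₁ γ₂ : absoluteGaloisGroup K}
  {lam : HeckeCharacter K} {Ω δ : ℂ} {Ωp : ℂ_[p]}

/-- **THE SAME PREDICATE**: `M` is a `λ`-twisted two-variable Katz sheet (goldfeld frame) iff
`toNested M` is a `λ`-twisted two-variable Katz measure branch (eis frame) — same parameters, same
interpolation value `DeShalit1987.interpolationValue`, same range. [cite: deShalit1987, II.4.17 (54) (p. 78)] -/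
theorem DeShalit1987.isKatzSheet_iff_isKatzMeasure₂_toNested (M : MvPowerSeries (Fin 2) (PadicComplexInt p)) :
    DeShalit1987.IsKatzSheet ι v vbar S κ₁ κ₂ γ₁ γ₂ lam Ω δ Ωp M ↔
      IsKatzMeasure₂ ι v vbar S κ₁ κ₂ γ₁ γ₂ lam Ω δ Ωp (MvPowerSeries.toNested M) := by
  unfold DeShalit1987.IsKatzSheet IsKatzMeasure₂
  simp only [DeShalit1987.IntSeries₂.hasValueAt_iff_hasValueAt₂_toNested]
  rfl

/-- The nested-to-multivariate form. [cite: deShalit1987, II.4.17 (54) (p. 78)] -/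
theorem DeShalit1987.isKatzSheet_ofNested_iff (G : PowerSeries (PowerSeries (PadicComplexInt p))) :
    DeShalit1987.IsKatzSheet ι v vbar S κ₁ κ₂ γ₁ γ₂ lam Ω δ Ωp (MvPowerSeries.ofNested G) ↔
      IsKatzMeasure₂ ι v vbar S κ₁ κ₂ γ₁ γ₂ lam Ω δ Ωp G := by
  rw [DeShalit1987.isKatzSheet_iff_isKatzMeasure₂_toNested, MvPowerSeries.toNested_ofNested]

/-- Existence in one frame is existence in the other. [cite: deShalit1987, II.4.17 (54) (p. 78)] -/
theorem DeShalit1987.exists_isKatzSheet_iff_exists_isKatzMeasure₂ :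
    (∃ M, DeShalit1987.IsKatzSheet ι v vbar S κ₁ κ₂ γ₁ γ₂ lam Ω δ Ωp M) ↔
      ∃ G, IsKatzMeasure₂ ι v vbar S κ₁ κ₂ γ₁ γ₂ lam Ω δ Ωp G :=
  ⟨fun ⟨M, hM⟩ ↦ ⟨_, (DeShalit1987.isKatzSheet_iff_isKatzMeasure₂_toNested M).mp hM⟩,
    fun ⟨G, hG⟩ ↦ ⟨_, (DeShalit1987.isKatzSheet_ofNested_iff G).mpr hG⟩⟩

end Values

/-! ### §4. Parity-free existence in the `bsd-eis` frame -/

/-- **The two-variable Katz–de Shalit measure branches EXIST at every split prime, `p = 2` INCLUDED, in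
the frame `IsKatzMeasure₂` of `Rubin1991/TwoVariableMainConjecture.lean`** — granted the parity-free fact
`DeShalit1987.thmII417_exists_katzSheet` (de Shalit II.4.17 (54) with Thm. 4.14; "`1 + 4ℤ₂` if `p = 2`"):
for `K` imaginary quadratic, `p = vv̄` split with `v` induced by `ι`, there are `Ω ≠ 0`, `δ`
(`δ² = ±d_K`), `Ω_p ∈ R₀ˣ` such that for every modulus `S` away from `p`, every algebraic twist `λ`
unramified outside `S ∪ {v, v̄}` and every generator pair `(κ₁, κ₂; γ₁, γ₂)`
(`ZpExtension.IsTopGeneratorPair` — independence is automatic, `IsDualBasis.isIndependent`), some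
`G ∈ 𝒪_{ℂ_p}⟦T₂⟧⟦T₁⟧` satisfies `IsKatzMeasure₂ ι v v̄ S κ₁ κ₂ γ₁ γ₂ λ Ω δ Ω_p G`. The `2 < p` facts of that
file (Rubin 1991 Thm. 4.1 / 5.3) are untouched; this supplies their ANALYTIC input at `p = 2`.
[cite: deShalit1987, II.4.17 (54) and the closing sentence (p. 78), II Thm. 4.14 (36) (p. 71), II.2.7 (p. 48)] -/
theorem DeShalit1987.thmII417_exists_katzSheet.exists_isKatzMeasure₂
    (h : DeShalit1987.thmII417_exists_katzSheet) (p : ℕ) [Fact p.Prime] (K : Type) [Field K]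
    [NumberField K] (hK : IsImaginaryQuadratic K) (ι : PadicAlgCl p ≃+* ℂ)
    (v vbar : HeightOneSpectrum (𝓞 K)) (hv : ((p : ℕ) : 𝓞 K) ∈ v.asIdeal)
    (hvbar : ((p : ℕ) : 𝓞 K) ∈ vbar.asIdeal) (hne : vbar ≠ v)
    (hι : ∀ (w : InfinitePlace K) (k : 𝓞 K), k ∈ v.asIdeal ↔ ‖ι.symm (w.embedding (k : K))‖ < 1) :
    ∃ (Ω δ : ℂ) (Ωp : (unrIntegers p)ˣ), Ω ≠ 0 ∧
      (δ ^ 2 = (NumberField.discr K : ℂ) ∨ δ ^ 2 = -(NumberField.discr K : ℂ)) ∧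
      ∀ (S : Finset (HeightOneSpectrum (𝓞 K))), v ∉ S → vbar ∉ S →
      ∀ (lam : HeckeCharacter K), lam.IsAlgebraic →
        (∀ w : HeightOneSpectrum (𝓞 K), w ∉ S → w ≠ v → w ≠ vbar → lam.IsUnramifiedAt w) →
      ∀ (κ₁ κ₂ : ZpExtension K p) (γ₁ γ₂ : absoluteGaloisGroup K),
        ZpExtension.IsTopGeneratorPair κ₁ κ₂ γ₁ γ₂ →
        ∃ G : PowerSeries (PowerSeries (PadicComplexInt p)),
          IsKatzMeasure₂ ι v vbar S κ₁ κ₂ γ₁ γ₂ lam Ω δ ((Ωp : unrIntegers p) : ℂ_[p]) G := by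
  obtain ⟨Ω, δ, Ωp, hΩ, hδ, hall⟩ := h p K hK ι v vbar hv hvbar hne hι
  refine ⟨Ω, δ, Ωp, hΩ, hδ, fun S hvS hvbS lam hlam hunr κ₁ κ₂ γ₁ γ₂ hpair ↦ ?_⟩
  have hdual : κ₁.IsDualBasis κ₂ γ₁ γ₂ := ZpExtension.isDualBasis_iff_isTopGeneratorPair.mpr hpair
  obtain ⟨M, hM⟩ := hall S hvS hvbS lam hlam hunr κ₁ κ₂ γ₁ γ₂ hdual.isIndependent hdual
  exact DeShalit1987.exists_isKatzSheet_iff_exists_isKatzMeasure₂.mp ⟨M, hM⟩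

/-! ### §5. From the two-variable sheet to the ONE-variable branches (appended; proofs only) -/

section Restrict

variable {p : ℕ} [Fact p.Prime] {K : Type u} [Field K] [NumberField K]
  {ι : PadicAlgCl p ≃+* ℂ} {v vbar : HeightOneSpectrum (𝓞 K)}
  {S : Finset (HeightOneSpectrum (𝓞 K))} {κ₁ κ₂ : ZpExtension K p} {γ₁ γ₂ : absoluteGaloisGroup K}
  {lam : HeckeCharacter K} {Ω δ : ℂ} {Ωp : ℂ_[p]}

/-- **A two-variable sheet restricts to the one-variable `κ₂`-branch of de Shalit's frame**
(`DeShalit1987.IsKatzBranch`, gen 4): if `M ∈ 𝒪_{ℂ_p}⟦T₁,T₂⟧` is the `λ`-twisted sheet for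
`(κ₁, κ₂; γ₁, γ₂)` with `κ₂(γ₁) = 0`, then `M(0, T₂)` — the constant coefficient in the outer variable of
`toNested M` — is the `λ`-twisted `κ₂`-branch at `γ₂` (a character through `κ₂` has `r(γ₁) = 1`, so its
point is `(0, r(γ₂) − 1)`; (54) at `s₁ = 0` is (52)). Transported from
`IsKatzMeasure₂.isKatzBranch_constantCoeff` (cell `bsd-eis`) along the bridge.
[cite: deShalit1987, II.4.17 (52)–(54) (p. 77–78)] -/
theorem DeShalit1987.IsKatzSheet.isKatzBranch_right {M : MvPowerSeries (Fin 2) (PadicComplexInt p)}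
    (hM : DeShalit1987.IsKatzSheet ι v vbar S κ₁ κ₂ γ₁ γ₂ lam Ω δ Ωp M) (hγ₁ : κ₂ γ₁ = 1) :
    DeShalit1987.IsKatzBranch ι v vbar S κ₂ γ₂ lam Ω δ Ωp
      (PowerSeries.constantCoeff (MvPowerSeries.toNested M)) :=
  ((DeShalit1987.isKatzSheet_iff_isKatzMeasure₂_toNested M).mp hM).isKatzBranch_constantCoeff hγ₁

/-- **The two-variable fact RECOVERS one-variable branches** (coherence of the gen-5 fact
`thmII417_exists_katzSheet` with the gen-4 fact `thmII414_exists_katzBranch`, same period data): granted the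
two-variable fact, for every `ℤ_p`-extension `κ₂` of `K` that is a member of a dual-basis pair
`(κ₁, κ₂; γ₁, γ₂)` (every `ℤ_p`-extension of an imaginary quadratic field is — `ℤ_p`-rank `2` — but that
is not proved here, so the complement is a hypothesis), every modulus `S` and algebraic twist `λ`, there
is a `λ`-twisted `κ₂`-BRANCH `G ∈ 𝒪_{ℂ_p}⟦T⟧` at `γ₂` in de Shalit's one-variable frame — at every prime
`p`, `p = 2` included. [cite: deShalit1987, II.4.17 (52)–(54) (p. 77–78), II Thm. 4.14 (p. 71)] -/
theorem DeShalit1987.thmII417_exists_katzSheet.exists_isKatzBranch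
    (h : DeShalit1987.thmII417_exists_katzSheet) (p : ℕ) [Fact p.Prime] (K : Type) [Field K]
    [NumberField K] (hK : IsImaginaryQuadratic K) (ι : PadicAlgCl p ≃+* ℂ)
    (v vbar : HeightOneSpectrum (𝓞 K)) (hv : ((p : ℕ) : 𝓞 K) ∈ v.asIdeal)
    (hvbar : ((p : ℕ) : 𝓞 K) ∈ vbar.asIdeal) (hne : vbar ≠ v)
    (hι : ∀ (w : InfinitePlace K) (k : 𝓞 K), k ∈ v.asIdeal ↔ ‖ι.symm (w.embedding (k : K))‖ < 1) :
    ∃ (Ω δ : ℂ) (Ωp : (unrIntegers p)ˣ), Ω ≠ 0 ∧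
      (δ ^ 2 = (NumberField.discr K : ℂ) ∨ δ ^ 2 = -(NumberField.discr K : ℂ)) ∧
      ∀ (S : Finset (HeightOneSpectrum (𝓞 K))), v ∉ S → vbar ∉ S →
      ∀ (lam : HeckeCharacter K), lam.IsAlgebraic →
        (∀ w : HeightOneSpectrum (𝓞 K), w ∉ S → w ≠ v → w ≠ vbar → lam.IsUnramifiedAt w) →
      ∀ (κ₁ κ₂ : ZpExtension K p) (γ₁ γ₂ : absoluteGaloisGroup K), κ₁.IsDualBasis κ₂ γ₁ γ₂ →
        ∃ G : PowerSeries (PadicComplexInt p),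
          DeShalit1987.IsKatzBranch ι v vbar S κ₂ γ₂ lam Ω δ ((Ωp : unrIntegers p) : ℂ_[p]) G := by
  obtain ⟨Ω, δ, Ωp, hΩ, hδ, hall⟩ := h p K hK ι v vbar hv hvbar hne hι
  refine ⟨Ω, δ, Ωp, hΩ, hδ, fun S hvS hvbS lam hlam hunr κ₁ κ₂ γ₁ γ₂ hdual ↦ ?_⟩
  obtain ⟨M, hM⟩ := hall S hvS hvbS lam hlam hunr κ₁ κ₂ γ₁ γ₂ hdual.isIndependent hdual
  exact ⟨_, hM.isKatzBranch_right hdual.2.1⟩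

end Restrict

end Literature.NumberTheory.EllipticCurves

end
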